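import Summits.HodgeConjecture.HodgeConjecture.Theorems.MarkmanPartnerTransportLowPicardRMCellOneTwoKugaSatake
import Summits.HodgeConjecture.HodgeConjecture.Theorems.MarkmanPartnerTransportIsometrySpannedThirdOfThreeFacts

/-!
# Route MarkmanPartnerTransport · crux `LowPicardRealMultiplication` (stmt-HodgeConjecture-19653) —
# «Kuga–Satake for X ⇒ HC⁴(X)» for EVERY marked projective `K3^{[2]}`-type fourfold of Picard rank `1`

Sequel to `…LowPicardRMCellOneTwoKugaSatake` (prover seat hodge-nonav-19652-p1, gen 9): there the implication is
proved for the fourfolds with genuine real multiplication (`¬ SpannedByIsometries`); the isometry-spanned ones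
(`E(X) = ℚ` or CM) are support #3 `IsometrySpannedThird` BY NAME (`isometrySpannedThird_of_three_facts`, mod
{Verbitsky–Guan, Charles–Markman 2013, Markman 2024}). Together:

* `hodgeConjectureFor_of_picard_one_of_kugaSatake'` — **for every marked smooth projective `K3^{[2]}`-type `X`
  with `ρ(X) = 1`: the Kuga–Satake statement for `X` (`IsKSCorrespondenceAlgebraicHK 2`) implies
  `HodgeConjectureFor 4 X`**, modulo the named facts {Verbitsky–Guan, O'Grady 2008, Charles–Markman 2013,
  Varesco 2023 Cor. 4.6, Beauville 1983, Markman 2024}. (Picard rank `1` is the generic projective case — e.g. a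
  very general polarised deformation; for `E(X) = ℚ` the content is support #3, for `E(X)` real quadratic it is
  T1 «ORPH-KS» through «RM-GEN».)

CONDITIONAL on the Kuga–Satake statement (OPEN in print for `K3^{[n]}`-type); no definition, no sorry, no new named
fact; nothing here proves HC or crux #5. `--supports stmt-HodgeConjecture-19653`.

References: M. Varesco, Math. Z. 305 (2023) Cor. 4.6, Thm. 5.4, Conj. 4.2; E. Markman, J. Eur. Math. Soc. (2024),
Thm. 1.1 (arXiv:2204.00516); F. Charles, E. Markman, Compos. Math. 149 (2013) Thm. 1.1.
-/

noncomputable section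

set_option linter.dupNamespace false

open Module CategoryTheory
open Literature.AlgebraicTopology.SingularHomology Literature.Geometry.Kaehler
open Literature.AlgebraicGeometry Literature.AlgebraicGeometry.Motives Literature.AlgebraicGeometry.HodgeTheory
open Literature.AlgebraicGeometry.Hyperkaehler Literature.AlgebraicGeometry.Surfaces
open Summit.HodgeConjecture.HodgeConjecture.Theorems.NikulinTwinTransport
open Summit.HodgeConjecture.HodgeConjecture.Theorems.MarkmanPartnerTransport

namespace Summit.HodgeConjecture.HodgeConjecture.Theorems.MarkmanPartnerTransport.PartnerLattice

/-- `MarkedK3Sq[X, φ, P, z]`: VERBATIM the `let MarkedK3Sq := …` binder of the route declarations of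
MarkmanPartnerTransport (clauses (m1)–(m6)). Local notation only. -/
local notation3 (prettyPrint := false) "MarkedK3Sq[" X ", " φ ", " P ", " z "]" =>
  (((IsIntegralClass P ∧ ∀ Q : complexBetti X (2 * 4), IsIntegralClass Q → ∃ n : ℤ, Q = n • P) ∧
    (∀ c : complexBetti X 2, IsIntegralClass c ↔ ∃ v : K3HilbertIndex → ℤ, φ c = fun i => (v i : ℂ)) ∧
    (∀ a : complexBetti X 2, cupPowTwo a 4 = ((3 : ℂ) * (k3HilbertForm 2 (φ a) (φ a)) ^ 2) • P) ∧
    (IsOfHodgeType 4 X 2 2 0 (LinearEquiv.symm φ z) ∧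
      ∀ τ : complexBetti X 2, IsOfHodgeType 4 X 2 2 0 τ → ∃ t : ℂ, τ = t • LinearEquiv.symm φ z) ∧
    (∀ c : complexBetti X 2, IsOfHodgeType 4 X 2 1 1 c ↔
      (k3HilbertForm 2 (φ c) z = 0 ∧ k3HilbertForm 2 (φ c) (star z) = 0)) ∧
    (k3HilbertForm 2 z z = 0 ∧ 0 < (k3HilbertForm 2 (star z) z).re)))

/-- `SpIso[X, φ]`: VERBATIM the `let SpannedByIsometries := …` binder of the route declarations. Local notation only. -/
local notation3 (prettyPrint := false) "SpIso[" X ", " φ "]" =>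
  (∀ f : complexBetti X 2 →ₗ[ℂ] complexBetti X 2, (∀ y, IsRationalClass y → IsRationalClass (f y)) →
    (∀ (i j : ℕ) y, IsOfHodgeType 4 X 2 i j y → IsOfHodgeType 4 X 2 i j (f y)) →
    (∀ d : complexBetti X 2, d ∈ algebraicClasses X 1 → f d = 0) →
    (∀ y : complexBetti X 2, ∀ d : complexBetti X 2, d ∈ algebraicClasses X 1 →
      k3HilbertForm 2 (φ (f y)) (φ d) = 0) →
    ∃ (k : ℕ) (c : Fin k → ℚ) (g : Fin k → (complexBetti X 2 →ₗ[ℂ] complexBetti X 2)),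
      (∀ i, Function.Bijective (g i) ∧ (∀ y, IsRationalClass y → IsRationalClass (g i y)) ∧
        (∀ (a b : ℕ) y, IsOfHodgeType 4 X 2 a b y → IsOfHodgeType 4 X 2 a b (g i y)) ∧
        (∀ a b, k3HilbertForm 2 (φ (g i a)) (φ (g i b)) = k3HilbertForm 2 (φ a) (φ b))) ∧
      ∀ y : complexBetti X 2, (∀ d : complexBetti X 2, d ∈ algebraicClasses X 1 →
        k3HilbertForm 2 (φ y) (φ d) = 0) → f y = ∑ i : Fin k, ((c i : ℂ) • g i y))

/-- `KSHC[hX]`: the Kuga–Satake statement for the fourfold (`hX : IsSmoothProjective 4 X`) (`IsKSCorrespondenceAlgebraicHK 2`). Local notation only. -/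
local notation3 (prettyPrint := false) "KSHC[" hX "]" => (IsKSCorrespondenceAlgebraicHK 2 hX)

variable {X : SchemeOver ℂ} {φ : complexBetti X 2 ≃ₗ[ℂ] (K3HilbertIndex → ℂ)} {P : complexBetti X (2 * 4)}
  {z : K3HilbertIndex → ℂ}

/-- **«Kuga–Satake for `X` ⇒ HC⁴(X)» at Picard rank `1`, all cases**: isometry-spanned ⇒ support #3 by name
(`isometrySpannedThird_of_three_facts`); otherwise `hodgeConjectureFor_of_picard_one_of_kugaSatake`. CONDITIONAL on
the Kuga–Satake statement for `X`; six named facts displayed. Credits nothing to HC.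
[cite: Varesco2023, Cor. 4.6 and Conj. 4.2] [cite: Markman2024, Thm. 1.1] [cite: CharlesMarkman2013, Thm. 1.1 (§1)] -/
theorem hodgeConjectureFor_of_picard_one_of_kugaSatake'
    (hV : VerbitskyGuan_cohomology_K3HilbertSquareType) (hO : OGrady2008_dualBBFClass_algebraic)
    (hB : CharlesMarkman2013_lefschetzStandard_K3HilbertType)
    (hVar : Varesco2023_transcendentalHodgeSimilitude_algebraic_of_lefschetzStandard)
    (hBea : Beauville1983_irreducibleSymplectic_of_k3HilbertType)
    (hMk : Markman2024_rationalHodgeIsometry_algebraic_marked)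
    (hX : IsSmoothProjective 4 X) (hK : IsOfK3HilbertSquareType X) (hM : MarkedK3Sq[X, φ, P, z])
    (hρ : Module.finrank ℂ ↥(algebraicClasses X 1) = 1) (hKS : KSHC[hX]) : HodgeConjectureFor 4 X := by
  by_cases hsp : SpIso[X, φ]
  · exact isometrySpannedThird_of_three_facts hV hB hMk X hX hK φ P z hM hsp
  · exact hodgeConjectureFor_of_picard_one_of_kugaSatake hV hO hB hVar hBea hX hK hM hsp hρ hKS

end Summit.HodgeConjecture.HodgeConjecture.Theorems.MarkmanPartnerTransport.PartnerLattice

end
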